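import Summits.ResolutionOfSingularities.ResolutionOfSingularities.Theorems.FrobeniusClosingPatchingRelPerfectDepthSepFormat
import Summits.ResolutionOfSingularities.ResolutionOfSingularities.Theorems.FrobeniusClosingPatchingRelPerfectDepthMixedFormatBTraces
import Summits.ResolutionOfSingularities.ResolutionOfSingularities.Theorems.FrobeniusClosingPatchingRelPerfectDepthMixedFormatBStepLemmas
import Summits.ResolutionOfSingularities.ResolutionOfSingularities.Theorems.FrobeniusClosingPatchingRelPerfectDepthWeightedStepBookkeeping
import Summits.ResolutionOfSingularities.ResolutionOfSingularities.Theorems.FrobeniusClosingPatchingRelPerfectDepthSNCPointwiseTransport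
import Summits.ResolutionOfSingularities.ResolutionOfSingularities.Theorems.FrobeniusClosingPatchingRelPerfectDepthSNCSwap
import Summits.ResolutionOfSingularities.ResolutionOfSingularities.Theorems.FrobeniusClosingPatchingRelPerfectDepthBoundaryLiftPointwise
import Summits.ResolutionOfSingularities.ResolutionOfSingularities.Theorems.FrobeniusClosingPatchingRelPerfectDepthPocketInvariantHost
import Summits.ResolutionOfSingularities.ResolutionOfSingularities.Theorems.FrobeniusClosingPatchingRelPerfectDepthMixedTower
import Summits.ResolutionOfSingularities.ResolutionOfSingularities.Theorems.FrobeniusClosingPatchingRelPerfectDepthSepFormatStepKey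
import Summits.ResolutionOfSingularities.ResolutionOfSingularities.Theorems.FrobeniusClosingPatchingRelPerfectDepthSepFormatCotangent
import Summits.ResolutionOfSingularities.ResolutionOfSingularities.Theorems.FrobeniusClosingPatchingRelPerfectDepthHostRegularTransport
import HarnessLib

/-!
# Chain W5.2 — F6 STAGE 2: the formatted WEIGHT-ONE step `SepFormat.step` (content of `StepSepOne SepFormat`)

[OURS · L1 W5.2 · res-D-pv-016 AS res-L1-w52-stub-5, T6-X2 OWNER (res-L1-w52-plan-1 RULINGS 2026-08-27T09:17:34Z (3));
CONTENT form of `stepSepOne_holds : StepSepOne SepFormat` (TargetsF6 v1.1 7001d375 §5; the by-name closer is one line once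
the targets module is filed).]  NOT a statement of the manuscript under review; AI-written, weaker than expert review; fact-free.
One weight-one blowing up transports `SepFormat` (p520204): host `𝓗′ = σᶜ(𝓗, 1)` = strict transform
(`SepStep.strictTransformIdeal_eq_controlledTransform_one`, res-D-pv-026's (L-A)), list `𝒩′ = strict transforms ++
[(exceptional divisor, w + 1)]`, monomial bookkeeping (res-D-pv-021, res-D-pv-052), `HasSNC` transport (Kollár 3.85), the
POINTWISE cases at centre points — (T) tangent: res-D-pv-009's `SNCWithAt.tangent_swap`; (C) coincidence:
`coincidence_swap` / `swap`; (J) joint: res-D-pv-052's `sncWithAt_host_cons` — and pointwise transport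
(`IsBlowup.sncWithAt_transform_of_mem_support` / `_of_not_mem_support`) for host regularity, transversality and pockets.
References: Bierstone–Grigoriev–Milman–Włodarczyk, arXiv:1206.3090, §3.2 Lemma 3.2.1, §4 Step 2a
[BierstoneGrigorievMilmanWlodarczyk2011]; J. Kollár, *Lectures on Resolution of Singularities* (2007), (3.111) Step 3,
Cor. 3.85, 3.30.2 [Kollar2007].
-/

-- `Summit.<Summit>.<Sub>.Theorems` with `Sub = Summit` (single-conjunct summit, D-0017)
set_option linter.dupNamespace false

noncomputable section

open CategoryTheory CategoryTheory.Limits AlgebraicGeometry TopologicalSpace IsLocalRing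
open Literature.AlgebraicGeometry.Resolution
open Scheme.IdealSheafData

namespace Summit.ResolutionOfSingularities.ResolutionOfSingularities.Theorems

universe u

namespace DepthGraded

namespace SepFormat

/-- [OURS · L1 W5.2] **The formatted weight-one step of stage 2** (content of `StepSepOne SepFormat`).
[cite: BierstoneGrigorievMilmanWlodarczyk2011, §3.2 Lemma 3.2.1, §4 Step 2a] [cite: Kollar2007, (3.111) Step 3, Cor. 3.85] -/
theorem step (S : Type u) [CommRing S] [IsRegularLocalRing S] (I : Ideal S)
    (E X : Scheme.{u}) (i : E ⟶ X) (g : X ⟶ Spec (.of S)) (K N : X.IdealSheafData) (𝒟 : List (E.IdealSheafData × ℕ))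
    (hinv : DepthTargets.DepthInvariantMono 2 S I E X i g K N) (hQ : SepFormat i K N 𝒟)
    (E' : Scheme.{u}) (τ : E' ⟶ E) (C : E.IdealSheafData)
    (hC : Scheme.IsRegular C.subscheme) (hconn : _root_.IsPreconnected (C.support : Set E)) (hle : K.comap i ≤ C)
    (hsncE : HasSNCWith (boundaryOf 𝒟) C) (hU : UniformPieces 𝒟 C [C.support])
    (hjoint : ∀ z : E, z ∈ C.support →
      ¬ stalkIdeal (K.comap i) z ≤ maximalIdeal (E.presheaf.stalk z) ^ 2 →
        (∃ B ∈ boundaryOf 𝒟, z ∈ B.support ∧ stalkIdeal B z = stalkIdeal (K.comap i) z) ∨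
          DepthSNC.SNCWithAt (K.comap i :: (𝒟.filter fun p => 0 < p.2).map Prod.fst) C z)
    (hτ : IsBlowup τ C) :
    K ≤ C.map i ^ 1 ∧
    ∃ (X' : Scheme.{u}) (σ : X' ⟶ X) (i' : E' ⟶ X'),
      IsBlowup σ (C.map i) ∧ i' ≫ σ = τ ≫ i ∧
      DepthTargets.DepthInvariantMono 2 S I E' X' i' (σ ≫ g) (controlledTransform σ (C.map i) K 1)
        (N.comap σ * (C.map i).comap σ ^ (2 - 1)) ∧
      (controlledTransform σ (C.map i) K 1).comap i' = controlledTransform τ C (K.comap i) 1 ∧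
      SepFormat i' (controlledTransform σ (C.map i) K 1) (N.comap σ * (C.map i).comap σ ^ (2 - 1))
        (𝒟.map (fun p => (strictTransformIdeal τ C p.1, p.2)) ++
          [(C.comap τ, weightOf 𝒟 (divisorsOver 𝒟 C C.support) + 1)]) := by
  classical
  obtain ⟨𝓗, 𝒩, h𝓗, h𝒩c, h𝒩, hK, hN, hsnc, hreg, htrans, hpocket⟩ := hQ
  haveI := hinv.isNoetherian
  haveI := hinv.isClosedImmersion
  have hX : Scheme.IsRegular X := hinv.isRegular
  have hE : Scheme.IsRegular E := hinv.isRegular_exc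
  have hker : IsEffectiveCartier i.ker := hinv.isEffectiveCartier_ker
  haveI : IsLocallyNoetherian E := LocallyOfFiniteType.isLocallyNoetherian i
  -- notation
  set Ch : X.IdealSheafData := C.map i with hCh
  set w : ℕ := weightOf 𝒟 (divisorsOver 𝒟 C C.support) with hw
  have h𝔟 : K.comap i = 𝓗.comap i := comap_eq_of_eq hK
  -- S1: TRANSFER at weight one is free
  have hperm : K ≤ Ch ^ 1 := DepthTargets.le_map_of_comap_le i (by simpa using hle)
  -- S2: the step of the invariant
  obtain ⟨X', σ, i', hσ, hsq, hinv', hK'⟩ := hinv.step (ν := 1) (by norm_num) τ C hC hperm hτ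
  refine ⟨hperm, X', σ, i', hσ, hsq, hinv', hK', ?_⟩
  haveI : IsLocallyNoetherian X' := hσ.isLocallyNoetherian
  haveI : IsLocallyNoetherian E' := hτ.isLocallyNoetherian
  haveI := hinv'.isClosedImmersion
  -- S3: the HOST step
  have hfmt : HostMonoFormat 2 i K 𝓗 N := ⟨h𝓗, by rw [hK, hN]⟩
  have hfmt' := hfmt.step hX hE (ν := 1) (by norm_num) hC hperm hσ hτ hsq
  set exc : X'.IdealSheafData := Ch.comap σ with hexc
  set 𝓗' : X'.IdealSheafData := controlledTransform σ Ch 𝓗 1 with h𝓗'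
  set 𝒩' : List (X'.IdealSheafData × ℕ) :=
    𝒩.map (fun p => (strictTransformIdeal σ Ch p.1, p.2)) ++ [(exc, w + 1)] with h𝒩'
  -- X-side snc / uniformity of the boundary with the centre
  have hsncX : HasSNCWith (i.ker :: boundaryOf 𝒩) Ch := Trace.hasSNCWith_cons_boundaryOf_map i h𝒩 hsnc hsncE
  have hsncX' : HasSNCWith (boundaryOf 𝒩) Ch := Trace.hasSNCWith_boundaryOf_map i h𝒩 hsnc hsncE
  have hUX : UniformPieces 𝒩 Ch [Ch.support] := Trace.uniformPieces_map_of_traces i h𝒩 hU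
  -- the monomial bookkeeping: `σ^*N · 𝓘_exc = monomialIdeal 𝒩'`
  have hmono : N.comap σ * exc ^ (2 - 1) = monomialIdeal 𝒩' := by
    have h1 : (monomialIdeal 𝒩).comap σ =
        exc ^ weightOf 𝒩 (divisorsOver 𝒩 Ch Ch.support) *
          monomialIdeal (𝒩.map fun p => (strictTransformIdeal σ Ch p.1, p.2)) :=
      DepthTargets.comap_monomialIdeal_support hsncX' hσ hUX
    have h2 : weightOf 𝒩 (divisorsOver 𝒩 Ch Ch.support) = w := Trace.weightOf_divisorsOver_map_eq i h𝒩 C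
    rw [hN, h1, h2, h𝒩', monomialIdeal_append, monomialIdeal_singleton]
    simp only [show (2 : ℕ) - 1 = 1 from rfl, pow_succ, pow_zero, one_mul]
    rw [mul_comm (exc ^ w), mul_assoc]
  -- the centre inside the host and inside `E`; the host of order one along the centre
  have hkerCh : i.ker ≤ Ch := DepthOne.ker_le_map_centre i C
  have h𝓗Ch : 𝓗 ≤ Ch := by
    have h := hfmt.host_le.trans hperm
    rwa [pow_one] at h
  have hChreg : Scheme.IsRegular Ch.subscheme := DepthOne.isRegular_subscheme_map i C hC
  have hconnX : _root_.IsPreconnected (Ch.support : Set X) := by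
    rw [hCh, coe_support_map_of_isClosedImmersion]
    exact hconn.image _ i.continuous.continuousOn
  have hcentreE : ∀ z : E, z ∈ C.support → z ∈ (K.comap i).support := fun z hz =>
    Scheme.IdealSheafData.support_antitone hle hz
  have hcentreH : ∀ z : E, z ∈ C.support → i.base z ∈ 𝓗.support := fun z hz => by
    have h := hcentreE z hz
    rw [h𝔟] at h
    exact (Trace.mem_support_comap_iff i 𝓗 z).mp h
  have hst𝓗 : strictTransformIdeal σ Ch 𝓗 = 𝓗' :=
    SepStep.strictTransformIdeal_eq_controlledTransform_one hX hChreg hconnX hker hkerCh h𝓗 h𝓗Ch hσ fun y hy => by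
      obtain ⟨z, hz, rfl⟩ := Trace.exists_eq_of_mem_support_map i hy
      exact (hreg z (hcentreH z hz)).not_stalkIdeal_le_sq List.mem_cons_self (hcentreH z hz)
  have hstE : i'.ker = strictTransformIdeal σ Ch i.ker :=
    SepStep.ker_eq_strictTransformIdeal_of_step hX hE hker hC hconn hσ hτ hsq
  -- the strict transforms restrict to the strict transforms of the traces
  have hst : ∀ G ∈ boundaryOf 𝒩, (strictTransformIdeal σ Ch G).comap i' = strictTransformIdeal τ C (G.comap i) :=
    fun G hG => Trace.comap_strictTransformIdeal_of_traces i h𝒩 hsncX' hsncE hU hσ hτ hsq hG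
  have hexci' : exc.comap i' = C.comap τ := by
    rw [hexc, ← Scheme.IdealSheafData.comap_comp, hsq, Scheme.IdealSheafData.comap_comp, hCh,
      DepthOne.comap_map_centre]
  -- points of `X'` over `i(E)` lie on `i'(E')` or over the centre (res-D-pv-009)
  have hrange : ∀ x' : X', σ.base x' ∈ Set.range i.base →
      x' ∈ Set.range i'.base ∨ σ.base x' ∈ (Ch.support : Set X) :=
    DepthSNC.mem_range_or_mem_support_of_strictTransform hX hE hC hσ hτ hsq
  /- KEY (…DepthSepFormatStepKey): at every centre point `x = i z` a family containing the host and every CHARGED member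
  through `x`, drawn from `𝓘_E :: boundaryOf 𝒩`, with simple normal crossings WITH the centre at `x`. -/
  have key : ∀ z : E, z ∈ C.support → ∃ L : List X.IdealSheafData,
      (∀ D ∈ L, D ∈ i.ker :: boundaryOf 𝒩) ∧
      (∀ p ∈ 𝒩, 0 < p.2 → i.base z ∈ p.1.support → p.1 ∈ L) ∧
      DepthSNC.SNCWithAt (𝓗 :: L) Ch (i.base z) := fun z hz =>
    SepStep.exists_sncWithAt_host_centre hker h𝓗 h𝒩c h𝒩 h𝔟 hreg htrans hle h𝓗Ch hsncE hsncX hjoint hz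
  -- transport of KEY to the points over a centre point
  have keyUp : ∀ x' : X', σ.base x' ∈ (Ch.support : Set X) → ∃ L : List X.IdealSheafData,
      (∀ D ∈ L, D ∈ i.ker :: boundaryOf 𝒩) ∧
      (∀ p ∈ 𝒩, 0 < p.2 → σ.base x' ∈ p.1.support → p.1 ∈ L) ∧
      DepthSNC.SNCWithAt (𝓗' :: (L.map (strictTransformIdeal σ Ch) ++ [exc])) ⊤ x' := by
    intro x' hx'
    obtain ⟨z, hz, hzx⟩ := Trace.exists_eq_of_mem_support_map i hx'
    obtain ⟨L, hLsub, hLch, hLsnc⟩ := key z hz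
    refine ⟨L, hLsub, fun p hp hpos hxp => hLch p hp hpos (hzx ▸ hxp), ?_⟩
    have h := hσ.sncWithAt_transform_of_mem_support x' (by rw [← hzx]; exact hLsnc) hx'
    rw [List.map_cons, List.cons_append, hst𝓗] at h
    exact h
  refine ⟨𝓗', 𝒩', hfmt'.1, ?_, ?_, ?_, hmono, ?_, ?_, ?_, ?_⟩
  · -- every member of `𝒩'` is an effective Cartier divisor
    intro G' hG'
    rw [h𝒩', Trace.boundaryOf_map_strict_append] at hG'
    rcases List.mem_append.mp hG' with h | h
    · obtain ⟨G, hG, rfl⟩ := List.mem_map.mp h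
      have hfac := Trace.comap_eq_pow_mul_strictTransformIdeal hsncX' hUX (fun _ h => h) hσ hG
      have hc : IsEffectiveCartier (G.comap σ) := (h𝒩c G hG).comap_of_isBlowup hσ
      rw [hfac] at hc
      exact hc.of_mul_right
    · rw [List.mem_singleton] at h
      rw [h]
      exact hσ.isEffectiveCartier
  · -- the traces of `𝒩'`
    rw [h𝒩', List.map_append, Trace.map_comap_map_strict_eq i i' (strictTransformIdeal σ Ch)
      (strictTransformIdeal τ C) h𝒩 hst]
    simp only [List.map_cons, List.map_nil, hexci']
  · -- `K' = 𝓗' ⊔ monomialIdeal 𝒩' · 𝓘_{E'}²`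
    rw [← hmono]
    exact hfmt'.2
  · -- `HasSNC (𝓘_{E'} :: boundaryOf 𝒩')` (Kollár 3.85)
    have h1 := hsncX.hasSNC_transform hσ
    rw [hstE, h𝒩', Trace.boundaryOf_map_strict_append]
    simpa only [List.map_cons, List.cons_append] using h1
  · -- HOST REGULAR ALONG `E'`
    intro z' hz'
    by_cases hc : σ.base (i'.base z') ∈ (Ch.support : Set X)
    · obtain ⟨L, -, -, hLsnc⟩ := keyUp (i'.base z') hc
      exact hLsnc.anti fun D hD _ => by rw [List.mem_singleton.mp hD]; exact List.mem_cons_self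
    · have hx : σ.base (i'.base z') ∈ 𝓗.support :=
        DepthSNC.mem_support_of_mem_support_controlledTransform Ch 𝓗 1 _ hz'
      have hxz : σ.base (i'.base z') = i.base (τ.base z') := by
        have h := congrArg (fun φ : E' ⟶ X => φ.base z') hsq
        simpa only [Scheme.Hom.comp_base, TopCat.coe_comp, Function.comp_apply] using h
      have h0 : DepthSNC.SNCWithAt [𝓗] ⊤ (σ.base (i'.base z')) := by
        rw [hxz]; exact hreg (τ.base z') (hxz ▸ hx)
      have h := DepthSNC.sncWithAt_strictTransform_host_of_not_mem_support hσ (i'.base z') hc h0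
      rw [hst𝓗] at h
      exact h.anti fun D hD _ => by rw [List.mem_singleton.mp hD]; exact List.mem_cons_self
  · -- TRANSVERSALITY at the charged coincidences of the new state
    intro p' hp' hpos' z' hz'p heq'
    set x' := i'.base z' with hx'
    have hxz : σ.base x' = i.base (τ.base z') := by
      have h := congrArg (fun φ : E' ⟶ X => φ.base z') hsq
      simpa only [Scheme.Hom.comp_base, TopCat.coe_comp, Function.comp_apply] using h
    rw [h𝒩'] at hp'
    rcases List.mem_append.mp hp' with hp' | hp'
    · -- an old member `p' = (st G, a)`
      obtain ⟨p, hp, rfl⟩ := List.mem_map.mp hp'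
      have hGbd : p.1 ∈ boundaryOf 𝒩 := fst_mem_boundaryOf hp
      have hx'G : x' ∈ (strictTransformIdeal σ Ch p.1).support := (Trace.mem_support_comap_iff i' _ z').mp hz'p
      have hxG : σ.base x' ∈ p.1.support := by
        have h := Scheme.IdealSheafData.support_antitone
          ((comap_le_controlledTransform σ Ch p.1 0).trans (controlledTransform_le_strictTransformIdeal σ Ch p.1 0)) hx'G
        rwa [Scheme.IdealSheafData.support_comap] at h
      by_cases hc : σ.base x' ∈ (Ch.support : Set X)
      · obtain ⟨L, -, hLch, hLsnc⟩ := keyUp x' hc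
        have hmem : strictTransformIdeal σ Ch p.1 ∈ L.map (strictTransformIdeal σ Ch) ++ [exc] :=
          List.mem_append_left _ (List.mem_map_of_mem (hLch p hp hpos' hxG))
        exact hLsnc.anti fun D hD _ => by
          rcases List.mem_cons.mp hD with rfl | hD
          · exact List.mem_cons_self
          · rw [List.mem_singleton.mp hD]; exact List.mem_cons_of_mem _ hmem
      · -- off the centre: the coincidence descends and the old clause transports
        have hzC : τ.base z' ∉ C.support := fun h => hc (by rw [hxz]; exact Trace.apply_mem_support_map i h)
        have heqE : stalkIdeal (strictTransformIdeal τ C (p.1.comap i)) z' =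
            stalkIdeal (controlledTransform τ C (K.comap i) 1) z' := by
          rw [← hst p.1 hGbd, ← hK']; exact heq'
        have hcoin : stalkIdeal (p.1.comap i) (τ.base z') = stalkIdeal (K.comap i) (τ.base z') :=
          SepStep.stalkIdeal_eq_of_coincidence_off_centre hτ _ _ 1 hzC heqE
        have hzG : τ.base z' ∈ (p.1.comap i).support := (Trace.mem_support_comap_iff i _ _).mpr (hxz ▸ hxG)
        have hHG : DepthSNC.SNCWithAt [𝓗, p.1] ⊤ (σ.base x') := by
          rw [hxz]; exact htrans p hp hpos' (τ.base z') hzG hcoin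
        have h := hσ.sncWithAt_transform_of_not_mem_support x' hHG hc
        rw [List.map_cons, List.map_cons, List.map_nil, hst𝓗] at h
        exact (h.top).anti fun D hD _ => by
          rcases List.mem_cons.mp hD with rfl | hD
          · exact List.mem_cons_self
          · rw [List.mem_singleton.mp hD]
            exact List.mem_cons_of_mem _ List.mem_cons_self
    · -- the new member `exc`: only over the centre
      rw [List.mem_singleton] at hp'
      subst hp'
      have hc : σ.base x' ∈ (Ch.support : Set X) := by
        have h := (Trace.mem_support_comap_iff i' exc z').mp hz'p
        rwa [hexc, Scheme.IdealSheafData.support_comap] at h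
      obtain ⟨L, -, -, hLsnc⟩ := keyUp x' hc
      exact hLsnc.anti fun D hD _ => by
        rcases List.mem_cons.mp hD with rfl | hD
        · exact List.mem_cons_self
        · rw [List.mem_singleton.mp hD]; exact List.mem_cons_of_mem _ (List.mem_append_right _ (List.mem_singleton_self _))
  · -- POCKETS: the END family at the cosupport points of `K'` off `i'(E')`
    intro x' hx'K hx'E
    have hxK : σ.base x' ∈ (K.support : Set X) :=
      DepthSNC.mem_support_of_mem_support_controlledTransform Ch K 1 x' hx'K
    have hbd' : boundaryOf (𝒩'.filter fun p => 0 < p.2) =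
        (boundaryOf (𝒩.filter fun p => 0 < p.2)).map (strictTransformIdeal σ Ch) ++ [exc] := by
      rw [h𝒩']; exact SepStep.boundaryOf_filter_strict_append _ 𝒩 exc w
    rw [hbd']
    by_cases hc : σ.base x' ∈ (Ch.support : Set X)
    · -- a POCKET point over the centre
      obtain ⟨L, -, hLch, hLsnc⟩ := keyUp x' hc
      refine hLsnc.anti fun D hD hxD => ?_
      rcases List.mem_cons.mp hD with rfl | hD
      · exact List.mem_cons_self
      rcases List.mem_cons.mp hD with rfl | hD
      · have h1 : x' ∈ (i'.ker.support : Set X') := hxD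
        rw [← DepthSNC.range_eq_support_ker i'] at h1
        exact absurd h1 hx'E
      rcases List.mem_append.mp hD with hD | hD
      · obtain ⟨G, hG, rfl⟩ := List.mem_map.mp hD
        obtain ⟨p, hp, hpos, rfl⟩ := SepStep.mem_boundaryOf_filter_iff.mp hG
        have hxG : σ.base x' ∈ p.1.support := by
          have h := Scheme.IdealSheafData.support_antitone
            ((comap_le_controlledTransform σ Ch p.1 0).trans (controlledTransform_le_strictTransformIdeal σ Ch p.1 0)) hxD
          rwa [Scheme.IdealSheafData.support_comap] at h
        exact List.mem_cons_of_mem _ (List.mem_append_left _ (List.mem_map_of_mem (hLch p hp hpos hxG)))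
      · exact List.mem_cons_of_mem _ (List.mem_append_right _ hD)
    · -- a FROZEN point: `σ x'` is a cosupport point of `K` off `i(E)`
      have hxE : σ.base x' ∉ Set.range i.base := fun h => by
        rcases hrange x' h with h1 | h1
        · exact hx'E h1
        · exact hc h1
      have h0 := hpocket (σ.base x') hxK hxE
      have h := hσ.sncWithAt_transform_of_not_mem_support x' h0 hc
      rw [List.map_cons, List.map_cons, List.cons_append, List.cons_append, hst𝓗, ← hstE] at h
      exact (h.top).anti fun D hD _ => by
        rcases List.mem_cons.mp hD with rfl | hD
        · exact List.mem_cons_self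
        rcases List.mem_cons.mp hD with rfl | hD
        · exact List.mem_cons_of_mem _ List.mem_cons_self
        · exact List.mem_cons_of_mem _ (List.mem_cons_of_mem _ hD)

end SepFormat

end DepthGraded

end Summit.ResolutionOfSingularities.ResolutionOfSingularities.Theorems

end
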